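/-
Copyright (c) 2026 the pub-hodgecm-mathlib formalisation cell (harness21).  Prover seat hodgecm-mathlib-LH4-p13 (g8), req620 Track A «(D-RAM) FOUR-FRAME» squad, tier 0,
STAGE-1b PRE-SCOPING (heir LEAD F0P3a-plan (g20) T19-24 «allowed as scoping»; dealer LH4-plan (g12) WORD #45): organ (L-lab) «THE LABEL LAW» of the rows
`stub_rows_transvPlus ∕ stub_rows_transvMinus` — brick (L-lab-6) «THE CROSS-TERM SLICE»: the value set and the label of a HEISENBERG element on the near-transvection
shell, clean window and unclean band.  2026-09-04.
-/
import Summits.HodgeConjecture.HodgeConjecture.Theorems.F0P3cDyRamSmulXPlusLabel   -- ★ p858904 (this seat, (L-lab-3)): `valueSetMod_smul_xPlus`, `labelPlus_smul_xPlus_iff_exists_norm`; brings ★ №3 Pieces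
                                                                                    -- (`valueSetMod`, `xPlus`, `LabelPlus`), ★ `pairing_antidiagonal`, ★ `B₀_three_apply`, ★ `v_inv_varpi_pow_mul_le_one_iff`, ★ `WildQuadraticDatumRefSkewScalar`
import Literature.NumberTheory.LocalFields.WildQuadraticDatumTrace                 -- ★ (LH4-p03): `v_add_map_le_exp`, `exists_v_le_add_map_eq` (trace images `Tr 𝔭_E^j = 𝔭_F^{⌊(j+d)∕2⌋}`); brings ★ `exists_fixed_coords_of_map_ne`
import HarnessLib

/-!
# Crux `H413`, line LH4 «(D-RAM) FOUR-FRAME», tier 0, STAGE-1b pre-scoping — (L-lab-6) «THE CROSS-TERM SLICE»: the hermitian value set `⟨y, (n − 1)y⟩ mod ϖ^m` of a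
# Heisenberg element `n = u(x, z)` and its transvection label — clean window (`= e • X₊`, label = norm class of `e`) and unclean band (no label of any class)

Cell `hodgecm-mathlib` (D-0151), FLOOR 0, crux item H413 = `stmt-HodgeConjecture-24833`, route of record `HCCMUnconditional`; squad F0∕P3c∕LH4.  SCOPING INVENTORY for the
LEAD's PLAN-T1 v19 (L-lab)∕(L-T+) paragraphs; THEOREMS ONLY (no `def`, no instance, no notation, no `sorry`, default heartbeats), ★-only imports, lane
`--supports stmt-HodgeConjecture-24833 --as helper`; pays NO row, states NO law.  Consumers: LH4-p10 (g5) (N-vol-wild) FILE 4 «the labelled shell fibre volume»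
(★ p859059 `HeisenbergWildChartFibre` writes `u(x,z)_w − 1 = !![0, x_w, z_w; 0, 0, −σx_w; 0, 0, 0]`, ★ `map_heisElt_sub_one_eq` — the literal below), LH4-p08 (g7)
09:38:51Z∕09:39:41Z (iv) (the `x ≠ 0` slice of the Levi fibre), F0P3-p01 (g35) FIBRE-VOLUMES 775a2121 §1 + POINTER 09:50:24Z (the two obstructions, machine-checked d = 2..5).

THE MATHEMATICS.  `σ` an involution of the field `K` (valued, `σ` isometric, for §2 on), `Φ₃ = antidiag(1,1,1)`, `t₊ = (ϖ − σϖ)·((ϖσϖ)^{⌊d∕2⌋})⁻¹` the skew coefficient of the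
reference nilpotent ★ `xPlus σ ϖ d = t₊·E₀₂` (`|t₊| = exp(−ℓ₀)`, `ℓ₀ = d % 2`), `m* = ℓ₀ + 2d − 1` the level of record.  A Heisenberg element of `U(Φ₃)` is `n = u(x, z)` with
`X := n − 1 = !![0, x, z; 0, 0, −σx; 0, 0, 0]` and `z + σz = −x·σx` (unitarity).  Its hermitian values on integral vectors are
  **`⟨y, X y⟩_{Φ₃} = (t − σt) + z·N(y₂)`,  `t := x·(y₁·σy₂)`,  `N(a) := a·σa`**  (§1)
— a CROSS TERM `t − σt ∈ (1 − σ)(x·𝒪)` plus the CORNER TERM `z·N(y₂)`.  Two obstructions keep the `ϖ^m`-thickened value set off the skew line `t₊·(σ-fixed)`: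
(i) the cross terms, which die modulo `ϖ^m` iff `(1 − σ)(x𝒪) ⊆ ϖ^m𝒪`; (ii) the symmetric part of `z` (`z + σz = −N(x)`), which is `ϖ^m`-close to a skew element iff
`N(x) ∈ Tr(ϖ^m𝒪)`.  In valuations (ramified quadratic datum `(σ, ϖ, d, t)`: `σ`-fixed elements have even valuation, `|ϖ − σϖ| = |ϖ|^d`, `|2| = |ϖ|^t`):
(i) holds once `|x| ≤ |ϖ|^k` with `2n ≤ k`, `m ≤ d + 2n` for some `n` (i.e. `k ≥ d + ℓ₀` at `m = m*`; Eisenstein coordinates, §4 `v_sub_map_le_exp`: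
`(1 − σ)𝔭_E^j ⊆ (ϖ − σϖ)·𝔭_F^{⌈(j−1)∕2⌉}`), and (ii) holds once `m + d ≤ 2k + 1` (★ `exists_v_le_add_map_eq`: `𝔭_F^{⌊(m+d)∕2⌋} ⊆ Tr 𝔭_E^m`), and FAILS — for every skew
`z′`, `|z − z′| > |ϖ|^m` — once `|x| = |ϖ|^k` with `2k + 2 ≤ m + d` (★ `v_add_map_le_exp`: `Tr 𝔭_E^m ⊆ 𝔭_F^{⌊(m+d)∕2⌋}`).  At a WILD datum (`d ≥ 2`) and `m = m*`,
(ii) implies (i), so the threshold is the single number `k_clean(d) = ⌊(m* + d)∕2⌋` of F0P3-p01's table (`3d∕2 − 1` even `d`, `(3d − 1)∕2` odd `d ≥ 3`).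

* §1 `pairing_heis_mulVec` (the value formula; `σ` involutive, any field), `valueSetMod_heis`, `mem_valueSetMod_heis` (`z` itself is a value: `y = e₂`).
* §2 CLEAN WINDOW (abstract): **`valueSetMod_heis_eq_valueSetMod_smul_xPlus`** — if the cross terms die mod `ϖ^m` and `z ≡ z′ (mod ϖ^m)` with `e·t₊ = z′`, then
  `valueSetMod σ ϖ m X = valueSetMod σ ϖ m (e • xPlus σ ϖ d)`; hence `labelPlus_heis_iff_labelPlus_smul_xPlus`, and over a complete sheet datum at `m = m*` with `z′` SKEW
  of valuation `exp(−ℓ₀)` (the shell): **`labelPlus_heis_iff_exists_norm`** — `LabelPlus σ ϖ d m* X ↔ ∃ u, u·σu = e` (★ (L-lab-3) `labelPlus_smul_xPlus_iff_exists_norm`;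
  `e = z′∕t₊` is a `σ`-fixed unit).  «On the clean part the label is the norm class of the skew coordinate» (F0P3-p01 §1; LH4-p08 (iv)).
* §3 UNCLEAN BAND (abstract): **`valueSetMod_heis_ne_valueSetMod_smul_xPlus_of_far`** — if NO skew `z′` is `ϖ^m`-close to `z`, then for EVERY `σ`-fixed `e` the value
  sets of `X` and `e • X₊` differ (`z ∈` the former; every value of `e • X₊` is skew); so `not_labelPlus_heis_of_far` (`e = 1`) AND no «LabelMinus′» either (`e` a
  non-norm unit): the Lean piece `pieceTransvMinus = shell ∧ ¬LabelPlus` holds there, the engine's `T−` does not (F0P3-p01 09:32:17Z «≠», class 'X').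
* §4 DATUM ARITHMETIC (one-field currency of ★ `WildQuadraticDatumTrace`, hypotheses conjunct by conjunct): `v_sub_map_le_exp` (the `(1 − σ)`-image bound),
  `forall_v_cross_le_one` ((i) from depth), `exists_skew_near_of_depth` ((ii) from depth), `not_v_sub_skew_le_of_shallow` (¬(ii) below the threshold).
* §5 HEADS AT THE DATUM: **`exists_skew_valueSetMod_heis_eq_of_deep`** (wild `d ≥ 2`, `m = m*`, `|x| ≤ |ϖ|^k`, `m* + d ≤ 2k + 1` ⇒ ∃ skew `z′ ≡ z` and
  `valueSetMod X = valueSetMod (e • X₊)` for every `e` with `e·t₊ = z′`), **`labelPlus_heis_iff_exists_norm_of_deep`** (complete: the label is the norm class of `z′∕t₊`),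
  **`valueSetMod_heis_ne_of_shallow`** ∕ **`not_labelPlus_heis_of_shallow`** (`|x| = |ϖ|^k`, `2k + 2 ≤ m + d` ⇒ no class at all; any `d ≥ 1`, no completeness).
HONEST LABEL.  Count-neutral scoping brick; the three tier-0 rows stay OPEN; the fibre VOLUMES (LH4-p10 FILE 4) and the (L-T+) amplitude letter are NOT here; `HC_CM` is
proved only modulo the 7 printed citations (2 remaining named inputs: hLiu418 = `stmt-HodgeConjecture-24832`, h413 = `stmt-HodgeConjecture-24833`) until rung 0 closes.

## References
* [Rogawski1990] J. D. Rogawski, *Automorphic Representations of Unitary Groups in Three Variables*, Ann. of Math. Stud. 123 (1990), §1.10 p. 9 (the Heisenberg group `N`,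
  `z + z̄ = −xx̄`), §4.9 Prop. 4.9.1 (b) p. 55 (orbital integrals along `N`; the two transvection classes).
* [Serre1979] J.-P. Serre, *Local Fields*, GTM 67 (1979), Ch. III §3 Prop. 7 (trace images and the different), Ch. V §3 Cor. 3 (norms of one-units of a ramified
  quadratic extension).
* [Kottwitz1986BaseChangeUnits] R. E. Kottwitz, *Base change for unit elements of Hecke algebras*, Compositio Math. 60 (1986), §1 pp. 240–241 (congruence-level pieces as
  lattice conditions).
* [LanglandsShelstad1987] R. P. Langlands, D. Shelstad, *On the definition of transfer factors*, Math. Ann. 278 (1987), §3 (the sign attached to the two unipotent classes).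
-/

set_option autoImplicit false

noncomputable section

namespace Summit.HodgeConjecture.HodgeConjecture.Cruxes.H413.F0P3cDyRamHeisenbergShellValueSet

open Literature.NumberTheory.Automorphic Literature.NumberTheory.Automorphic.HermitianLattice Literature.NumberTheory.Automorphic.UnitaryGroup
open Literature.NumberTheory.Automorphic.UnitaryLatticeTree Literature.NumberTheory.Automorphic.UnitaryThreeFourFrame
open Literature.NumberTheory.LocalFields Literature.NumberTheory.LocalFields.WildQuadraticDatum
open Summit.HodgeConjecture.HodgeConjecture.Cruxes.H413.F0P3cDyRamFourFramePieces
open Summit.HodgeConjecture.HodgeConjecture.Cruxes.H413.F0P3cDyRamShellLabelPlus (v_inv_varpi_pow_mul_le_one_iff)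
open Summit.HodgeConjecture.HodgeConjecture.Cruxes.H413.F0P3cDyRamSmulXPlusLabel (valueSetMod_smul_xPlus labelPlus_smul_xPlus_iff_exists_norm)
open scoped Matrix Valued
open WithZero

variable {K : Type} [Field K] [Valued K ℤᵐ⁰]

/-! ## §1  The hermitian value of a Heisenberg element -/

omit [Valued K ℤᵐ⁰] in
/-- **THE HERMITIAN VALUE OF A HEISENBERG ELEMENT.**  For an involution `σ` and `X = !![0, x, z; 0, 0, −σx; 0, 0, 0]` (`= u(x, z) − 1` in the Heisenberg chart of `U(Φ₃)`,
★ `map_heisElt_sub_one_eq`): `⟨y, X y⟩_{Φ₃} = (t − σt) + z·(y₂·σy₂)` with `t = x·(y₁·σy₂)` — a CROSS TERM in `(1 − σ)(x·𝒪)` plus the CORNER TERM `z·N(y₂)` (the twin of ★ (L-lab-0)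
`pairing_frameElt_sub_one_mulVec` for the unipotent population). [cite: Rogawski1990, §1.10 p. 9] [cite: Rogawski1990, §4.9 Prop. 4.9.1 (b) p. 55] -/
theorem pairing_heis_mulVec {σ : K →+* K} (hσσ : ∀ a, σ (σ a) = a) (x z : K) (y : Fin 3 → K) :
    pairing σ ((StdForm.antidiagonal 3).over K) y ((!![0, x, z; 0, 0, -σ x; 0, 0, 0] : Matrix (Fin 3) (Fin 3) K) *ᵥ y) =
      (x * (y 1 * σ (y 2)) - σ (x * (y 1 * σ (y 2)))) + z * (y 2 * σ (y 2)) := by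
  rw [pairing_antidiagonal, B₀_three_apply]
  simp [Matrix.mulVec, dotProduct, Fin.sum_univ_three, map_mul, hσσ]
  ring

/-- **THE VALUE SET OF A HEISENBERG ELEMENT** (★ №3 `valueSetMod`, integral `y`): the `ϖ^m`-thickening of `{(t − σt) + z·N(y₂) | t = x·(y₁·σy₂), y integral}`.
[cite: Rogawski1990, §4.9 Prop. 4.9.1 (b) p. 55] [cite: Kottwitz1986BaseChangeUnits, §1 pp. 240–241] -/
theorem valueSetMod_heis {σ : K →+* K} (hσσ : ∀ a, σ (σ a) = a) (ϖ : K) (m : ℕ) (x z : K) :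
    valueSetMod σ ϖ m (!![0, x, z; 0, 0, -σ x; 0, 0, 0] : Matrix (Fin 3) (Fin 3) K) =
      {v | ∃ y : Fin 3 → K, (∀ a, Valued.v (y a) ≤ 1) ∧
        Valued.v ((ϖ ^ m)⁻¹ * (v - ((x * (y 1 * σ (y 2)) - σ (x * (y 1 * σ (y 2)))) + z * (y 2 * σ (y 2))))) ≤ 1} := by
  ext v
  simp only [valueSetMod, Set.mem_setOf_eq, pairing_heis_mulVec hσσ]

/-- The corner entry `z` is itself a value (at `y = e₂`: no cross term, `N(1) = 1`), at every level `m`. [cite: Rogawski1990, §4.9 Prop. 4.9.1 (b) p. 55] -/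
theorem mem_valueSetMod_heis {σ : K →+* K} (hσσ : ∀ a, σ (σ a) = a) (ϖ : K) (m : ℕ) (x z : K) :
    z ∈ valueSetMod σ ϖ m (!![0, x, z; 0, 0, -σ x; 0, 0, 0] : Matrix (Fin 3) (Fin 3) K) := by
  rw [valueSetMod_heis hσσ]
  refine ⟨![0, 0, 1], fun a => ?_, ?_⟩
  · fin_cases a <;> simp
  · have h1 : (![0, 0, 1] : Fin 3 → K) 1 = 0 := rfl
    have h2 : (![0, 0, 1] : Fin 3 → K) 2 = 1 := rfl
    rw [h1, h2, zero_mul, mul_zero, map_zero, sub_zero, map_one, mul_one, mul_one, zero_add, sub_self, mul_zero, map_zero]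
    exact zero_le_one

/-! ## §2  The clean window: cross terms dead and `z` congruent to a skew element ⇒ the value set of a scalar multiple of `X₊` -/

/-- **CLEAN WINDOW ⇒ `valueSetMod X = valueSetMod (e • X₊)`.**  `σ` an involutive isometry.  If every cross term dies modulo `ϖ^m` (`∀ a ∈ 𝒪, |(ϖ^m)⁻¹·(xa − σ(xa))| ≤ 1`)
and `z ≡ z′ (mod ϖ^m)`, then for every `e` with `e·t₊ = z′` the `ϖ^m`-thickened value sets of `X = !![0, x, z; 0, 0, −σx; 0, 0, 0]` and of `e • xPlus σ ϖ d` coincide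
(both are the thickening of `z′·N(𝒪)`: `→` read the value at `y` through `a = y₂`, `←` take `y = (0, 0, a)`). [cite: Rogawski1990, §4.9 Prop. 4.9.1 (b) p. 55] [cite: Serre1979, Ch. III §3 Prop. 7] -/
theorem valueSetMod_heis_eq_valueSetMod_smul_xPlus {σ : K →+* K} (hσσ : ∀ a, σ (σ a) = a) (hvσ : ∀ a, Valued.v (σ a) = Valued.v a) (ϖ : K) (d m : ℕ)
    {x z z' e : K} (hcross : ∀ a : K, Valued.v a ≤ 1 → Valued.v ((ϖ ^ m)⁻¹ * (x * a - σ (x * a))) ≤ 1)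
    (hzz' : Valued.v ((ϖ ^ m)⁻¹ * (z - z')) ≤ 1) (he : e * ((ϖ - σ ϖ) * ((ϖ * σ ϖ) ^ ((d - d % 2) / 2))⁻¹) = z') :
    valueSetMod σ ϖ m (!![0, x, z; 0, 0, -σ x; 0, 0, 0] : Matrix (Fin 3) (Fin 3) K) = valueSetMod σ ϖ m (e • xPlus σ ϖ d) := by
  have hN : ∀ a : K, Valued.v a ≤ 1 → Valued.v (a * σ a) ≤ 1 := fun a ha => by
    rw [map_mul, hvσ]; exact mul_le_one' ha ha
  have hzN : ∀ a : K, Valued.v a ≤ 1 → Valued.v ((ϖ ^ m)⁻¹ * ((z - z') * (a * σ a))) ≤ 1 := fun a ha => by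
    rw [← mul_assoc, map_mul]; exact mul_le_one' hzz' (hN a ha)
  rw [valueSetMod_heis hσσ, valueSetMod_smul_xPlus]
  ext v
  simp only [Set.mem_setOf_eq]
  constructor
  · rintro ⟨y, hy, hv⟩
    refine ⟨y 2, hy 2, ?_⟩
    have hc := hcross (y 1 * σ (y 2)) (by rw [map_mul, hvσ]; exact mul_le_one' (hy 1) (hy 2))
    have key := Valuation.map_add_le _ (Valuation.map_add_le _ hv hc) (hzN (y 2) (hy 2))
    convert key using 2
    rw [← he]; ring
  · rintro ⟨a, ha, hv⟩
    refine ⟨![0, 0, a], fun i => ?_, ?_⟩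
    · fin_cases i
      · simp
      · simp
      · simpa using ha
    · have h1 : (![0, 0, a] : Fin 3 → K) 1 = 0 := rfl
      have h2 : (![0, 0, a] : Fin 3 → K) 2 = a := rfl
      have key := Valuation.map_sub_le _ hv (hzN a ha)
      rw [h1, h2]
      convert key using 2
      rw [← he, zero_mul, mul_zero, map_zero, sub_zero, zero_add]; ring

/-- Hence, in the clean window, **`LabelPlus σ ϖ d m X ↔ LabelPlus σ ϖ d m (e • xPlus σ ϖ d)`** — the Heisenberg label is the label of ONE scalar multiple of the reference
nilpotent, the object decided by ★ (L-lab-3). [cite: Rogawski1990, §4.9 Prop. 4.9.1 (b) p. 55] [cite: LanglandsShelstad1987, §3] -/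
theorem labelPlus_heis_iff_labelPlus_smul_xPlus {σ : K →+* K} (hσσ : ∀ a, σ (σ a) = a) (hvσ : ∀ a, Valued.v (σ a) = Valued.v a) (ϖ : K) (d m : ℕ)
    {x z z' e : K} (hcross : ∀ a : K, Valued.v a ≤ 1 → Valued.v ((ϖ ^ m)⁻¹ * (x * a - σ (x * a))) ≤ 1)
    (hzz' : Valued.v ((ϖ ^ m)⁻¹ * (z - z')) ≤ 1) (he : e * ((ϖ - σ ϖ) * ((ϖ * σ ϖ) ^ ((d - d % 2) / 2))⁻¹) = z') :
    LabelPlus σ ϖ d m (!![0, x, z; 0, 0, -σ x; 0, 0, 0] : Matrix (Fin 3) (Fin 3) K) ↔ LabelPlus σ ϖ d m (e • xPlus σ ϖ d) := by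
  rw [LabelPlus, LabelPlus, valueSetMod_heis_eq_valueSetMod_smul_xPlus hσσ hvσ ϖ d m hcross hzz' he]

/-- **THE LABEL IN THE CLEAN WINDOW IS THE NORM CLASS OF THE SKEW COORDINATE.**  Over a complete sheet datum `IsRamifiedQuadraticDatum σ ϖ d t`, at the level of record
`m* = d % 2 + 2d − 1`: if the cross terms die mod `ϖ^{m*}`, `z ≡ z′ (mod ϖ^{m*})` with `z′` SKEW of valuation `exp(−ℓ₀)` (the shell depth), and `e·t₊ = z′`, then `e` is a
`σ`-fixed unit and `LabelPlus σ ϖ d m* X ↔ ∃ u, u·σu = e` (★ `labelPlus_smul_xPlus_iff_exists_norm`).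
[cite: Serre1979, Ch. V §3 Cor. 3] [cite: Rogawski1990, §4.9 Prop. 4.9.1 (b) p. 55] [cite: LanglandsShelstad1987, §3] -/
theorem labelPlus_heis_iff_exists_norm [IsAdicComplete 𝓂[K] 𝒪[K]] {σ : K →+* K} {ϖ : K} {d t : ℕ} (hD : IsRamifiedQuadraticDatum σ ϖ d t)
    {x z z' e : K} (hcross : ∀ a : K, Valued.v a ≤ 1 → Valued.v ((ϖ ^ (d % 2 + 2 * d - 1))⁻¹ * (x * a - σ (x * a))) ≤ 1)
    (hzz' : Valued.v ((ϖ ^ (d % 2 + 2 * d - 1))⁻¹ * (z - z')) ≤ 1) (hσz' : σ z' = -z') (hvz' : Valued.v z' = exp (-((d % 2 : ℕ) : ℤ)))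
    (he : e * ((ϖ - σ ϖ) * ((ϖ * σ ϖ) ^ ((d - d % 2) / 2))⁻¹) = z') :
    LabelPlus σ ϖ d (d % 2 + 2 * d - 1) (!![0, x, z; 0, 0, -σ x; 0, 0, 0] : Matrix (Fin 3) (Fin 3) K) ↔ ∃ u : K, u * σ u = e := by
  obtain ⟨hσσ, hvσ, hϖ, -, hd, -, -⟩ := id hD
  have htp0 := refSkewScalar_ne_zero hvσ hϖ hd
  have htpv := v_refSkewScalar hvσ hϖ hd
  -- `e = z′ ∕ t₊` is `σ`-fixed (both skew) and a unit (same valuation)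
  have hσe : σ e = e := by
    have h := congrArg σ he
    rw [map_mul, map_refSkewScalar_eq_neg hσσ, hσz', mul_neg, neg_inj, ← he] at h
    exact mul_right_cancel₀ htp0 h
  have he1 : Valued.v e = 1 := by
    have h := congrArg Valued.v he
    rw [map_mul, htpv, hvz'] at h
    have hne : (exp (-((d % 2 : ℕ) : ℤ)) : ℤᵐ⁰) ≠ 0 := exp_ne_zero
    calc Valued.v e = Valued.v e * exp (-((d % 2 : ℕ) : ℤ)) * (exp (-((d % 2 : ℕ) : ℤ)))⁻¹ := by rw [mul_inv_cancel_right₀ hne]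
      _ = 1 := by rw [h, mul_inv_cancel₀ hne]
  rw [labelPlus_heis_iff_labelPlus_smul_xPlus hσσ hvσ ϖ d _ hcross hzz' he]
  exact labelPlus_smul_xPlus_iff_exists_norm hD hσe he1

/-! ## §3  The unclean band: `z` far from every skew element ⇒ no class at all -/

/-- **UNCLEAN BAND ⇒ THE VALUE SET IS NOT THAT OF ANY `σ`-FIXED MULTIPLE OF `X₊`.**  If no skew `z′` is `ϖ^m`-close to `z`, then for every `σ`-fixed `e` the thickened value
sets of `X` and `e • X₊` differ: `z` is a value of `X` (§1), while every value `e·t₊·N(a)` of `e • X₊` is skew. [cite: Rogawski1990, §4.9 Prop. 4.9.1 (b) p. 55] [cite: Serre1979, Ch. III §3 Prop. 7] -/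
theorem valueSetMod_heis_ne_valueSetMod_smul_xPlus_of_far {σ : K →+* K} (hσσ : ∀ a, σ (σ a) = a) (ϖ : K) (d m : ℕ) {x z : K}
    (hfar : ∀ z' : K, σ z' = -z' → ¬ Valued.v ((ϖ ^ m)⁻¹ * (z - z')) ≤ 1) {e : K} (hσe : σ e = e) :
    valueSetMod σ ϖ m (!![0, x, z; 0, 0, -σ x; 0, 0, 0] : Matrix (Fin 3) (Fin 3) K) ≠ valueSetMod σ ϖ m (e • xPlus σ ϖ d) := by
  intro hEq
  have hz := mem_valueSetMod_heis hσσ ϖ m x z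
  rw [hEq, valueSetMod_smul_xPlus] at hz
  obtain ⟨a, -, ha⟩ := hz
  refine hfar (e * ((ϖ - σ ϖ) * ((ϖ * σ ϖ) ^ ((d - d % 2) / 2))⁻¹ * (a * σ a))) ?_ ha
  rw [map_mul, map_mul, hσe, map_refSkewScalar_eq_neg hσσ, map_mul, hσσ, mul_comm (σ a) a]
  ring

/-- In particular **no `LabelPlus`** in the unclean band (`e = 1`). [cite: Rogawski1990, §4.9 Prop. 4.9.1 (b) p. 55] -/
theorem not_labelPlus_heis_of_far {σ : K →+* K} (hσσ : ∀ a, σ (σ a) = a) (ϖ : K) (d m : ℕ) {x z : K}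
    (hfar : ∀ z' : K, σ z' = -z' → ¬ Valued.v ((ϖ ^ m)⁻¹ * (z - z')) ≤ 1) :
    ¬ LabelPlus σ ϖ d m (!![0, x, z; 0, 0, -σ x; 0, 0, 0] : Matrix (Fin 3) (Fin 3) K) := by
  intro hL
  refine valueSetMod_heis_ne_valueSetMod_smul_xPlus_of_far (x := x) hσσ ϖ d m hfar (map_one σ) ?_
  rw [one_smul]
  exact hL

/-! ## §4  Datum arithmetic: the two obstructions in terms of the depth of `x` -/

/-- **THE `(1 − σ)`-IMAGE BOUND** `(1 − σ)𝔭_E^j ⊆ (ϖ − σϖ)·𝔭_F^{⌈(j−1)∕2⌉}` in valuations: for `σ` an involution whose fixed elements have even valuation, `|ϖ| = exp(−1)`,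
`|ϖ − σϖ| = |ϖ|^d`: if `|b| ≤ exp(−j)` and `2n ≤ j` then `|b − σb| ≤ exp(−(d + 2n))` (Eisenstein coordinates `b = a₀ + a₁ϖ`: `b − σb = a₁·(ϖ − σϖ)`, `|a₁ϖ| ≤ |b|`, `|a₁|` even).
[cite: Serre1979, Ch. III §3 Prop. 7] -/
theorem v_sub_map_le_exp {σ : K →+* K} {ϖ : K} {d : ℕ} (hσ : ∀ x, σ (σ x) = x) (hfix : ∀ x : K, σ x = x → x ≠ 0 → ∃ n : ℤ, Valued.v x = exp (2 * n))
    (hϖ : Valued.v ϖ = exp (-1 : ℤ)) (hd : Valued.v (ϖ - σ ϖ) = Valued.v ϖ ^ d)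
    {b : K} {j n : ℤ} (hb : Valued.v b ≤ exp (-j)) (hn : 2 * n ≤ j) :
    Valued.v (b - σ b) ≤ exp (-((d : ℤ) + 2 * n)) := by
  obtain ⟨a₀, a₁, ha₀, ha₁, rfl⟩ := exists_fixed_coords_of_map_ne hσ (map_varpi_ne hϖ hd) b
  have hsub : a₀ + a₁ * ϖ - σ (a₀ + a₁ * ϖ) = a₁ * (ϖ - σ ϖ) := by rw [map_add, map_mul, ha₀, ha₁]; ring
  rw [hsub, map_mul, hd, v_varpi_pow hϖ]
  rcases eq_or_ne a₁ 0 with rfl | h0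
  · rw [map_zero, zero_mul]; exact zero_le
  obtain ⟨p, hp⟩ := hfix a₁ ha₁ h0
  have hmax := v_fixed_add_fixed_mul_eq_max (even_log_v_of_fixed hfix) hϖ ha₀ ha₁
  have h1 : Valued.v a₁ * exp (-1 : ℤ) ≤ exp (-j) := (le_max_right _ _).trans (hmax ▸ hb)
  rw [hp, ← exp_add, exp_le_exp] at h1
  rw [hp, ← exp_add, exp_le_exp]
  omega

/-- **(i) FROM DEPTH**: if `|x| ≤ exp(−k)`, `2n ≤ k` and `m ≤ d + 2n`, every cross term dies modulo `ϖ^m`: `∀ a ∈ 𝒪, |(ϖ^m)⁻¹·(xa − σ(xa))| ≤ 1` (at `m = m*`: `k ≥ d + ℓ₀`).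
[cite: Serre1979, Ch. III §3 Prop. 7] -/
theorem forall_v_cross_le_one {σ : K →+* K} {ϖ : K} {d : ℕ} (hσ : ∀ x, σ (σ x) = x) (hfix : ∀ x : K, σ x = x → x ≠ 0 → ∃ n : ℤ, Valued.v x = exp (2 * n))
    (hϖ : Valued.v ϖ = exp (-1 : ℤ)) (hd : Valued.v (ϖ - σ ϖ) = Valued.v ϖ ^ d)
    {x : K} {k n : ℤ} {m : ℕ} (hx : Valued.v x ≤ exp (-k)) (hn : 2 * n ≤ k) (hm : (m : ℤ) ≤ d + 2 * n) :
    ∀ a : K, Valued.v a ≤ 1 → Valued.v ((ϖ ^ m)⁻¹ * (x * a - σ (x * a))) ≤ 1 := by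
  intro a ha
  rw [v_inv_varpi_pow_mul_le_one_iff hϖ]
  have hxa : Valued.v (x * a) ≤ exp (-k) := by
    rw [map_mul]
    calc Valued.v x * Valued.v a ≤ exp (-k) * 1 := mul_le_mul' hx ha
      _ = exp (-k) := mul_one _
  exact (v_sub_map_le_exp hσ hfix hϖ hd hxa hn).trans (exp_le_exp.2 (by omega))

/-- **(ii) FROM DEPTH**: if `z + σz = −x·σx`, `|x| ≤ exp(−k)` and `m + d ≤ 2k + 1`, then `z` is `ϖ^m`-close to a SKEW element (`N(x) ∈ 𝔭_F^{k′}`, `2k′ = 2k`, lies in `Tr 𝔭_E^m`,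
★ `exists_v_le_add_map_eq`; subtract the preimage). [cite: Serre1979, Ch. III §3 Prop. 7] [cite: Rogawski1990, §1.10 p. 9] -/
theorem exists_skew_near_of_depth {σ : K →+* K} {ϖ : K} {d t : ℕ} (hσ : ∀ x, σ (σ x) = x) (hvσ : ∀ a, Valued.v (σ a) = Valued.v a)
    (hfix : ∀ x : K, σ x = x → x ≠ 0 → ∃ n : ℤ, Valued.v x = exp (2 * n))
    (hϖ : Valued.v ϖ = exp (-1 : ℤ)) (hd : Valued.v (ϖ - σ ϖ) = Valued.v ϖ ^ d) (ht : Valued.v (2 : K) = Valued.v ϖ ^ t)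
    {x z : K} (hxz : z + σ z = -(x * σ x)) {k : ℤ} {m : ℕ} (hx : Valued.v x ≤ exp (-k)) (hmk : (m : ℤ) + d ≤ 2 * k + 1) :
    ∃ z' : K, σ z' = -z' ∧ Valued.v ((ϖ ^ m)⁻¹ * (z - z')) ≤ 1 := by
  have hyfix : σ (-(x * σ x)) = -(x * σ x) := by rw [map_neg, map_mul, hσ, mul_comm]
  have hvy : Valued.v (-(x * σ x)) ≤ exp (-(2 * k)) := by
    rw [Valuation.map_neg, map_mul, hvσ]
    calc Valued.v x * Valued.v x ≤ exp (-k) * exp (-k) := mul_le_mul' hx hx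
      _ = exp (-(2 * k)) := by rw [← exp_add]; congr 1; ring
  obtain ⟨b, hb, hbb⟩ := exists_v_le_add_map_eq hσ hfix hϖ hd ht hyfix (j := m) (m := k) hvy hmk
  refine ⟨z - b, ?_, ?_⟩
  · have h1 : σ z = -(x * σ x) - z := by linear_combination hxz
    have h2 : σ b = -(x * σ x) - b := by linear_combination hbb
    rw [map_sub, h1, h2]; ring
  · rw [sub_sub_cancel, v_inv_varpi_pow_mul_le_one_iff hϖ]; exact hb

/-- **¬(ii) BELOW THE THRESHOLD**: if `z + σz = −x·σx` and `|x·σx| > exp(−2n)` for some `n` with `2n ≤ m + d` (e.g. `|x| = |ϖ|^k`, `2k + 2 ≤ m + d`), then NO skew `z′` is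
`ϖ^m`-close to `z` — else `−N(x) = Tr(z − z′) ∈ Tr 𝔭_E^m ⊆ 𝔭_F^{⌊(m+d)∕2⌋}` (★ `v_add_map_le_exp`). [cite: Serre1979, Ch. III §3 Prop. 7] [cite: Rogawski1990, §1.10 p. 9] -/
theorem not_v_sub_skew_le_of_shallow {σ : K →+* K} {ϖ : K} {d t : ℕ} (hσ : ∀ x, σ (σ x) = x)
    (hfix : ∀ x : K, σ x = x → x ≠ 0 → ∃ n : ℤ, Valued.v x = exp (2 * n))
    (hϖ : Valued.v ϖ = exp (-1 : ℤ)) (hd : Valued.v (ϖ - σ ϖ) = Valued.v ϖ ^ d) (ht : Valued.v (2 : K) = Valued.v ϖ ^ t)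
    {x z : K} (hxz : z + σ z = -(x * σ x)) {n : ℤ} {m : ℕ} (hn : 2 * n ≤ (m : ℤ) + d) (hxn : exp (-(2 * n)) < Valued.v (x * σ x))
    {z' : K} (hσz' : σ z' = -z') : ¬ Valued.v ((ϖ ^ m)⁻¹ * (z - z')) ≤ 1 := by
  intro h
  rw [v_inv_varpi_pow_mul_le_one_iff hϖ] at h
  have htr : (z - z') + σ (z - z') = -(x * σ x) := by rw [map_sub, hσz']; linear_combination hxz
  have key := v_add_map_le_exp hσ hfix hϖ hd ht h hn
  rw [htr, Valuation.map_neg] at key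
  exact not_le.2 hxn key

/-! ## §5  Heads at the datum -/

/-- **CLEAN WINDOW AT A WILD DATUM.**  `σ` an involutive isometry whose fixed elements have even valuation, `|ϖ| = exp(−1)`, `|ϖ − σϖ| = |ϖ|^d` with `d ≥ 2` (WILD), `|2| = |ϖ|^t`;
`z + σz = −x·σx`, `|x| ≤ exp(−k)` with `m* + d ≤ 2k + 1` (`m* = d % 2 + 2d − 1`; i.e. `k ≥ ⌊(m* + d)∕2⌋`).  Then there is a SKEW `z′ ≡ z (mod ϖ^{m*})`, and for every `e` with
`e·t₊ = z′`: `valueSetMod σ ϖ m* X = valueSetMod σ ϖ m* (e • xPlus σ ϖ d)` (at `d ≥ 2` the depth `⌊(m*+d)∕2⌋ ≥ d + ℓ₀` also kills the cross terms).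
[cite: Serre1979, Ch. III §3 Prop. 7] [cite: Rogawski1990, §4.9 Prop. 4.9.1 (b) p. 55] -/
theorem exists_skew_valueSetMod_heis_eq_of_deep {σ : K →+* K} {ϖ : K} {d t : ℕ} (hσ : ∀ x, σ (σ x) = x) (hvσ : ∀ a, Valued.v (σ a) = Valued.v a)
    (hfix : ∀ x : K, σ x = x → x ≠ 0 → ∃ n : ℤ, Valued.v x = exp (2 * n))
    (hϖ : Valued.v ϖ = exp (-1 : ℤ)) (hd : Valued.v (ϖ - σ ϖ) = Valued.v ϖ ^ d) (ht : Valued.v (2 : K) = Valued.v ϖ ^ t) (h2d : 2 ≤ d)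
    {x z : K} (hxz : z + σ z = -(x * σ x)) {k : ℤ} (hx : Valued.v x ≤ exp (-k)) (hmk : ((d % 2 + 2 * d - 1 : ℕ) : ℤ) + d ≤ 2 * k + 1) :
    ∃ z' : K, σ z' = -z' ∧ Valued.v ((ϖ ^ (d % 2 + 2 * d - 1))⁻¹ * (z - z')) ≤ 1 ∧
      ∀ e : K, e * ((ϖ - σ ϖ) * ((ϖ * σ ϖ) ^ ((d - d % 2) / 2))⁻¹) = z' →
        valueSetMod σ ϖ (d % 2 + 2 * d - 1) (!![0, x, z; 0, 0, -σ x; 0, 0, 0] : Matrix (Fin 3) (Fin 3) K) =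
          valueSetMod σ ϖ (d % 2 + 2 * d - 1) (e • xPlus σ ϖ d) := by
  obtain ⟨z', hσz', hzz'⟩ := exists_skew_near_of_depth hσ hvσ hfix hϖ hd ht hxz hx hmk
  have hcross := forall_v_cross_le_one hσ hfix hϖ hd (m := d % 2 + 2 * d - 1) (n := ((d + d % 2) / 2 : ℕ)) hx (by omega) (by omega)
  exact ⟨z', hσz', hzz', fun e he => valueSetMod_heis_eq_valueSetMod_smul_xPlus hσ hvσ ϖ d _ hcross hzz' he⟩

/-- **THE LABEL AT A WILD DATUM, CLEAN WINDOW** (complete sheet datum, `d ≥ 2`, `m = m*`): if `|x| ≤ exp(−k)`, `m* + d ≤ 2k + 1` (so the cross terms die), and `z′` is ANY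
skew element with `z ≡ z′ (mod ϖ^{m*})` (one exists by `exists_skew_valueSetMod_heis_eq_of_deep` when `z + σz = −x·σx`) of valuation `exp(−ℓ₀)`, then with `e·t₊ = z′`: `LabelPlus σ ϖ d m* X ↔ ∃ u, u·σu = e` — on the clean part of the shell fibre the label is
the norm class of the skew coordinate (F0P3-p01 FIBRE-VOLUMES §1: «exactly half of the clean part», by the conductor). [cite: Serre1979, Ch. V §3 Cor. 3] [cite: LanglandsShelstad1987, §3] -/
theorem labelPlus_heis_iff_exists_norm_of_deep [IsAdicComplete 𝓂[K] 𝒪[K]] {σ : K →+* K} {ϖ : K} {d t : ℕ} (hD : IsRamifiedQuadraticDatum σ ϖ d t) (h2d : 2 ≤ d)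
    {x z z' e : K} {k : ℤ} (hx : Valued.v x ≤ exp (-k)) (hmk : ((d % 2 + 2 * d - 1 : ℕ) : ℤ) + d ≤ 2 * k + 1)
    (hzz' : Valued.v ((ϖ ^ (d % 2 + 2 * d - 1))⁻¹ * (z - z')) ≤ 1) (hσz' : σ z' = -z') (hvz' : Valued.v z' = exp (-((d % 2 : ℕ) : ℤ)))
    (he : e * ((ϖ - σ ϖ) * ((ϖ * σ ϖ) ^ ((d - d % 2) / 2))⁻¹) = z') :
    LabelPlus σ ϖ d (d % 2 + 2 * d - 1) (!![0, x, z; 0, 0, -σ x; 0, 0, 0] : Matrix (Fin 3) (Fin 3) K) ↔ ∃ u : K, u * σ u = e := by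
  obtain ⟨hσσ, -, hϖ, hfix, hd, -, -⟩ := id hD
  have hcross := forall_v_cross_le_one hσσ hfix hϖ hd (m := d % 2 + 2 * d - 1) (n := ((d + d % 2) / 2 : ℕ)) hx (by omega) (by omega)
  exact labelPlus_heis_iff_exists_norm hD hcross hzz' hσz' hvz' he

/-- **THE UNCLEAN BAND AT THE DATUM** (any `d ≥ 1`, any level `m`, no completeness): if `z + σz = −x·σx`, `|x| = exp(−k)` and `2k + 2 ≤ m + d` (i.e. `k < ⌊(m+d)∕2⌋`), then
for every `σ`-fixed `e` the value sets of `X` and `e • X₊` at level `m` DIFFER — `X` carries neither the class-`+` label nor the label of any other class `e`.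
[cite: Serre1979, Ch. III §3 Prop. 7] [cite: Rogawski1990, §4.9 Prop. 4.9.1 (b) p. 55] -/
theorem valueSetMod_heis_ne_of_shallow {σ : K →+* K} {ϖ : K} {d t : ℕ} (hσ : ∀ x, σ (σ x) = x) (hvσ : ∀ a, Valued.v (σ a) = Valued.v a)
    (hfix : ∀ x : K, σ x = x → x ≠ 0 → ∃ n : ℤ, Valued.v x = exp (2 * n))
    (hϖ : Valued.v ϖ = exp (-1 : ℤ)) (hd : Valued.v (ϖ - σ ϖ) = Valued.v ϖ ^ d) (ht : Valued.v (2 : K) = Valued.v ϖ ^ t)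
    {x z : K} (hxz : z + σ z = -(x * σ x)) {k : ℤ} {m : ℕ} (hk : Valued.v x = exp (-k)) (hkm : 2 * k + 2 ≤ (m : ℤ) + d)
    {e : K} (hσe : σ e = e) :
    valueSetMod σ ϖ m (!![0, x, z; 0, 0, -σ x; 0, 0, 0] : Matrix (Fin 3) (Fin 3) K) ≠ valueSetMod σ ϖ m (e • xPlus σ ϖ d) := by
  have hxn : exp (-(2 * (k + 1))) < Valued.v (x * σ x) := by
    rw [map_mul, hvσ, hk, ← exp_add, exp_lt_exp]; omega
  exact valueSetMod_heis_ne_valueSetMod_smul_xPlus_of_far hσ ϖ d m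
    (fun z' hσz' => not_v_sub_skew_le_of_shallow hσ hfix hϖ hd ht hxz (n := k + 1) (by omega) hxn hσz') hσe

/-- **NO `LabelPlus` IN THE UNCLEAN BAND** (`|x| = exp(−k)`, `2k + 2 ≤ m + d`): the Lean piece `pieceTransvMinus = shell ∧ ¬LabelPlus` holds there although the element is in
neither transvection class at level `m` (F0P3-p01's class 'X'). [cite: Rogawski1990, §4.9 Prop. 4.9.1 (b) p. 55] [cite: Serre1979, Ch. III §3 Prop. 7] -/
theorem not_labelPlus_heis_of_shallow {σ : K →+* K} {ϖ : K} {d t : ℕ} (hσ : ∀ x, σ (σ x) = x) (hvσ : ∀ a, Valued.v (σ a) = Valued.v a)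
    (hfix : ∀ x : K, σ x = x → x ≠ 0 → ∃ n : ℤ, Valued.v x = exp (2 * n))
    (hϖ : Valued.v ϖ = exp (-1 : ℤ)) (hd : Valued.v (ϖ - σ ϖ) = Valued.v ϖ ^ d) (ht : Valued.v (2 : K) = Valued.v ϖ ^ t)
    {x z : K} (hxz : z + σ z = -(x * σ x)) {k : ℤ} {m : ℕ} (hk : Valued.v x = exp (-k)) (hkm : 2 * k + 2 ≤ (m : ℤ) + d) :
    ¬ LabelPlus σ ϖ d m (!![0, x, z; 0, 0, -σ x; 0, 0, 0] : Matrix (Fin 3) (Fin 3) K) := by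
  intro hL
  refine valueSetMod_heis_ne_of_shallow hσ hvσ hfix hϖ hd ht hxz hk hkm (map_one σ) ?_
  rw [one_smul]
  exact hL

end Summit.HodgeConjecture.HodgeConjecture.Cruxes.H413.F0P3cDyRamHeisenbergShellValueSet

end
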